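import Summits.NavierStokesRegularity.FluidComputer.SobolevLadderSerrin
import Literature.Analysis.FluidPDE.CheskidovDaiApriori
import Mathlib.MeasureTheory.Integral.Lebesgue.Countable
import Summits.NavierStokesRegularity.FluidComputer.DyadicOptimisation
import HarnessLib

/-!
# Fluid computer — the level dictionary ABOVE the amplitude end of the ladder (L53): the dyadic-palinstrophy clock
# `∑_j 16^j ‖Δ̇_j u(t)‖₂² ≳ ν^{4/3} ‖u(0)‖₂^{−2/3} (T − t)^{−4/3}` and its front form

HONEST FRAMING (cell `pub-fluidc`, verbatim): *low prior, high value-of-information experiment on Tao's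
machine paradigm; NOT a claim that NS blows up.* Theorem side of the cell; nothing here is evidence of blow-up.

The Sobolev ladder (L51–L52) stops at `s = 3/2`: above the amplitude end the route 'Leray `L^r` clock + embedding'
has no `L^r` partner. One rung above is still reachable from below with the ENERGY as the second currency: by
Cauchy–Schwarz over the levels, the block sups above a level `J` are controlled by the `ℓ²` row of index `2`,
`∑_{n≥0} ‖Δ̇_{J+n} u‖_∞ ≤ C_B 2^{(1−J)/2} (∑_{n≥0} 16^{J+n} ‖Δ̇_{J+n} u‖₂²)^{1/2}`, and the levels below `J` by the energy
(L22′). Along every maximal smooth Leray–Hopf solution of the unforced Navier–Stokes system on `ℝ³` (`ν > 0`):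

* `tsum_tail_blockSup_le_sqrt` — the Cauchy–Schwarz step (pure bookkeeping on a sequence of levels);
* `palinstrophy_front_clock` (**L53 — THE DYADIC-PALINSTROPHY FRONT CLOCK**): with the constant `c` of the sup clock
  L21/L22, for EVERY `t ∈ (0, T)` and EVERY `J ∈ ℤ`:
  `c √ν/√(T − t) ≤ C_∞ G ‖u(0)‖₂ 2^{3(J−1)/2} + C_B 2^{(1−J)/2} (∑_{n≥0} 16^{J+n} ‖Δ̇_{J+n} u(t)‖₂²)^{1/2}`;
* (`DyadicOptimisation.dyadic_optimisation` — real bookkeeping: `a ≤ α 2^{3J/2} + β 2^{−J/2} √d` for ALL `J`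
  forces `a^{8/3} ≤ 16 β² α^{2/3} d`);
* `palinstrophy_clock` (**L53′ — THE DYADIC-PALINSTROPHY CLOCK**): an absolute `κ > 0` with
  `κ · ν^{4/3} · (T − t)^{−4/3} ≤ ‖u(0)‖₂^{2/3} · ∑_{j∈ℤ} 16^j ‖Δ̇_j u(t)‖₂²` at EVERY `t ∈ (0, T)` — the `ℓ²` row of index
  `2` (the dyadic form of the PALINSTROPHY `‖∇²u‖₂²`, to which it is equivalent up to the toolbox's constants,
  `palinstrophy_clock_hessSq`) diverges at least like `(T − t)^{−4/3}`; `palinstrophy_lintegral_eq_top` (**L53″**):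
  `∫_{(t₀,T)} X^{3/4} = ∞` for the row `X = ‖u(0)‖₂^{2/3} ∑_j 16^j a_j²`.

Reading for the atlas. The cell's runs track the palinstrophy `P(t) = ∫|∇ω|² = ‖∇²u‖₂²`; the necessity says
`P(t) (T − t)^{4/3}` stays above `κ ν^{4/3} E₀^{−1/3}` (in form: log–log slope of `P` against `T − t` at most `−4/3`) and,
level by level, that the `16^j a_j²`-front must climb like `2^{J(t)} ≳ (ν/(T − t))^{1/3} ‖u(0)‖₂^{−2/3}` (the same per-level
countdown as the amplitude front L22″ — the two fronts are tied by Bernstein). HONEST SIZE NOTE: the exponent `4/3` is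
NOT sharp — the printed optimal rate is `‖u(t)‖_{Ḣ²} ≳ (T − t)^{−3/4}`, i.e. `P ≳ (T − t)^{−3/2}` (Robinson–Sadowski–Silva
2012, `3/2 < s < 5/2`, by the `Ḣ^s` energy method, not in the tree); the present `4/3 = 8/3 · 1/2` is what the sup clock
and the energy give by interpolation (`‖u‖_∞ ≲ ‖u‖₂^{1/4} ‖u‖_{Ḣ²}^{3/4}` in level form), with an explicit energy
dependence `E₀^{−1/3}`; constants inexplicit; class = `ℝ³` finite energy. Words and shapes, never numbers at the cell's
levels. Necessity only; nothing about sufficiency. 0 sorry; no new definitions, no named facts.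

## References

* J. Leray, Acta Math. 63 (1934), §19 (3.8)–(3.9) p. 224. [Leray1934]
* J. C. Robinson, W. Sadowski, R. P. Silva, J. Math. Phys. 53 (2012) 115618. [RobinsonSadowskiSilva2012]
* H. Bahouri, J.-Y. Chemin, R. Danchin, *Fourier Analysis and Nonlinear PDE*, Springer 2011, Lemma 2.1,
  Prop. 2.12. [BahouriCheminDanchin2011]
-/

noncomputable section

open MeasureTheory Set Function Filter Topology Metric
open scoped ENNReal NNReal
open Literature.Analysis.FluidPDE Literature.Analysis.FunctionSpaces
open Summit.NavierStokesRegularity.FluidComputer.BlockAmplitudeCeiling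
open Summit.NavierStokesRegularity.FluidComputer.LeraySupClock
open Summit.NavierStokesRegularity.FluidComputer.DyadicOptimisation

namespace Summit.NavierStokesRegularity.FluidComputer.PalinstrophyClock

/-! ## Cauchy–Schwarz over the levels above `J` -/

/-- **Cauchy–Schwarz over a tail of levels**: for any sequence `a : ℤ → [0, ∞]` and `J ∈ ℤ`,
`∑_{n≥0} 2^{3(J+n)/2} a_{J+n} ≤ 2^{(1−J)/2} (∑_{n≥0} 2^{4(J+n)} a_{J+n}²)^{1/2}` (`2^{3x/2} = 2^{−x/2}·2^{2x}` and
`∑_{n≥0} 2^{−(J+n)} = 2^{1−J}`; Hölder on the counting measure). [folklore] -/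
theorem tsum_tail_le_sqrt (a : ℤ → ℝ≥0∞) (J : ℤ) :
    ∑' n : ℕ, (2 : ℝ≥0∞) ^ ((3 / 2 : ℝ) * ((J + n : ℤ) : ℝ)) * a (J + n) ≤
      (2 : ℝ≥0∞) ^ ((1 - (J : ℝ)) / 2) *
        (∑' n : ℕ, (2 : ℝ≥0∞) ^ ((4 : ℝ) * ((J + n : ℤ) : ℝ)) * a (J + n) ^ 2) ^ (1 / 2 : ℝ) := by
  set f : ℕ → ℝ≥0∞ := fun n => (2 : ℝ≥0∞) ^ (-(((J + n : ℤ) : ℝ)) / 2) with hf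
  set g : ℕ → ℝ≥0∞ := fun n => (2 : ℝ≥0∞) ^ ((2 : ℝ) * ((J + n : ℤ) : ℝ)) * a (J + n) with hg
  have h2 : (2 : ℝ≥0∞) ≠ 0 := two_ne_zero
  have h2' : (2 : ℝ≥0∞) ≠ ⊤ := ENNReal.ofNat_ne_top
  -- the product `f g` is the summand
  have hfg : ∀ n, f n * g n = (2 : ℝ≥0∞) ^ ((3 / 2 : ℝ) * ((J + n : ℤ) : ℝ)) * a (J + n) := by
    intro n
    simp only [hf, hg]
    rw [← mul_assoc, ← ENNReal.rpow_add _ _ h2 h2']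
    congr 2
    ring
  -- Hölder on the counting measure
  have hH := ENNReal.lintegral_mul_le_Lp_mul_Lq (Measure.count : Measure ℕ) Real.HolderConjugate.two_two
    (measurable_from_nat (f := f)).aemeasurable (measurable_from_nat (f := g)).aemeasurable
  rw [lintegral_count, lintegral_count, lintegral_count] at hH
  simp only [Pi.mul_apply] at hH
  -- `∑ f² = 2^{1−J}`
  have hf2 : ∑' n : ℕ, f n ^ (2 : ℝ) = (2 : ℝ≥0∞) ^ (1 - (J : ℝ)) := by
    have hterm : ∀ n : ℕ, f n ^ (2 : ℝ) = (2 : ℝ≥0∞) ^ (-(J : ℝ)) * ((2 : ℝ≥0∞)⁻¹) ^ n := by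
      intro n
      simp only [hf]
      rw [← ENNReal.rpow_mul, ← ENNReal.rpow_neg_one, ← ENNReal.rpow_natCast, ← ENNReal.rpow_mul,
        ← ENNReal.rpow_add _ _ h2 h2']
      congr 1
      push_cast
      ring
    rw [tsum_congr hterm, ENNReal.tsum_mul_left, ENNReal.tsum_geometric, ENNReal.one_sub_inv_two, inv_inv,
      show (1 - (J : ℝ)) = -(J : ℝ) + 1 by ring, ENNReal.rpow_add _ _ h2 h2', ENNReal.rpow_one]
  -- `∑ g² = ∑ 16^{J+n} a²`
  have hg2 : ∑' n : ℕ, g n ^ (2 : ℝ) = ∑' n : ℕ, (2 : ℝ≥0∞) ^ ((4 : ℝ) * ((J + n : ℤ) : ℝ)) * a (J + n) ^ 2 := by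
    refine tsum_congr fun n => ?_
    simp only [hg]
    rw [ENNReal.mul_rpow_of_nonneg _ _ (by norm_num : (0 : ℝ) ≤ 2), ← ENNReal.rpow_mul, ENNReal.rpow_two]
    congr 2
    ring
  have hsq : ((2 : ℝ≥0∞) ^ (1 - (J : ℝ))) ^ (1 / (2 : ℝ)) = (2 : ℝ≥0∞) ^ ((1 - (J : ℝ)) / 2) := by
    rw [← ENNReal.rpow_mul]
    congr 1
    ring
  calc ∑' n : ℕ, (2 : ℝ≥0∞) ^ ((3 / 2 : ℝ) * ((J + n : ℤ) : ℝ)) * a (J + n)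
      = ∑' n : ℕ, f n * g n := tsum_congr fun n => (hfg n).symm
    _ ≤ (∑' n : ℕ, f n ^ (2 : ℝ)) ^ (1 / (2 : ℝ)) * (∑' n : ℕ, g n ^ (2 : ℝ)) ^ (1 / (2 : ℝ)) := hH
    _ = (2 : ℝ≥0∞) ^ ((1 - (J : ℝ)) / 2) *
        (∑' n : ℕ, (2 : ℝ≥0∞) ^ ((4 : ℝ) * ((J + n : ℤ) : ℝ)) * a (J + n) ^ 2) ^ (1 / 2 : ℝ) := by
        rw [hf2, hg2, hsq]

/-- **The block sups above a level are controlled by the `ℓ²` row of index `2`** (Bernstein `s_j ≤ C_B 2^{3j/2} a_j` and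
`tsum_tail_le_sqrt`): with the constant `C_B` of `BlockAmplitudeCeiling.exists_blockSup_le_blockL2`, for every `v ∈ L²`
and every `J`, `∑_{n≥0} ‖Δ̇_{J+n} v‖_∞ ≤ C_B 2^{(1−J)/2} (∑_{n≥0} 16^{J+n} ‖Δ̇_{J+n} v‖₂²)^{1/2}`.
[cite: BahouriCheminDanchin2011, Lemma 2.1] -/
theorem exists_tsum_tail_blockSup_le_sqrt :
    ∃ C : ℝ≥0, C ≠ 0 ∧ ∀ (v : EuclideanSpace ℝ (Fin 3) → EuclideanSpace ℝ (Fin 3)), MemLp v 2 volume → ∀ J : ℤ,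
      ∑' n : ℕ, blockSup v (J + n) ≤
        C * ((2 : ℝ≥0∞) ^ ((1 - (J : ℝ)) / 2) *
          (∑' n : ℕ, (2 : ℝ≥0∞) ^ ((4 : ℝ) * ((J + n : ℤ) : ℝ)) * blockL2 v (J + n) ^ 2) ^ (1 / 2 : ℝ)) := by
  obtain ⟨CB, hCB0, hB⟩ := exists_blockSup_le_blockL2
  refine ⟨CB, hCB0, fun v hv J => ?_⟩
  calc ∑' n : ℕ, blockSup v (J + n)
      ≤ ∑' n : ℕ, (CB : ℝ≥0∞) * ((2 : ℝ≥0∞) ^ ((3 / 2 : ℝ) * ((J + n : ℤ) : ℝ)) * blockL2 v (J + n)) := by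
        refine ENNReal.tsum_le_tsum fun n => ?_
        rw [← mul_assoc]
        refine (hB v hv (J + n)).trans_eq ?_
        congr 2
        congr 1
        ring
    _ = (CB : ℝ≥0∞) * ∑' n : ℕ, (2 : ℝ≥0∞) ^ ((3 / 2 : ℝ) * ((J + n : ℤ) : ℝ)) * blockL2 v (J + n) :=
        ENNReal.tsum_mul_left
    _ ≤ (CB : ℝ≥0∞) * ((2 : ℝ≥0∞) ^ ((1 - (J : ℝ)) / 2) *
          (∑' n : ℕ, (2 : ℝ≥0∞) ^ ((4 : ℝ) * ((J + n : ℤ) : ℝ)) * blockL2 v (J + n) ^ 2) ^ (1 / 2 : ℝ)) :=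
        mul_le_mul' le_rfl (tsum_tail_le_sqrt (blockL2 v) J)

/-! ## L53: the dyadic-palinstrophy front clock -/

/-- **L53 — THE DYADIC-PALINSTROPHY FRONT CLOCK.** With the constant `c` of the sup clock (`LeraySupClock.supNorm_clock`),
`C_∞ = (lpBounds (Fin 3)).Cinf`, `G = geomDim (Fin 3)` and `C_B` of `exists_tsum_tail_blockSup_le_sqrt`: along every maximal
smooth Leray–Hopf solution of the unforced system (`ν > 0`), for EVERY `t ∈ (0, T)` and EVERY `J ∈ ℤ`,
`c √ν/√(T − t) ≤ C_∞ ‖u(0)‖₂ 2^{3(J−1)/2} G + C_B 2^{(1−J)/2} (∑_{n≥0} 16^{J+n} ‖Δ̇_{J+n} u(t)‖₂²)^{1/2}` (L22′ with its tail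
of block sups bounded by the `ℓ²` row of index `2`). [cite: Leray1934, §19 (3.8)–(3.9) p. 224]
[cite: BahouriCheminDanchin2011, Lemma 2.1 and Prop. 2.12] -/
theorem palinstrophy_front_clock :
    ∃ c : ℝ, 0 < c ∧ ∃ C : ℝ≥0, C ≠ 0 ∧ ∀ (ν T : ℝ), 0 < ν → 0 < T →
      ∀ (u : ℝ → EuclideanSpace ℝ (Fin 3) → EuclideanSpace ℝ (Fin 3)) (p : ℝ → EuclideanSpace ℝ (Fin 3) → ℝ),
      IsMaximalSmoothSolution ν 0 u p T → IsLerayHopfOn T ν 0 (u 0) u →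
      ∀ t ∈ Ioo 0 T, ∀ J : ℤ, ENNReal.ofReal (c * Real.sqrt ν / Real.sqrt (T - t)) ≤
        ((lpBounds (Fin 3)).Cinf : ℝ≥0∞) * eLpNorm (u 0) 2 volume *
            (2 : ℝ≥0∞) ^ (((J - 1 : ℤ) : ℝ) * Fintype.card (Fin 3) * 2⁻¹) * LPBounds.geomDim (Fin 3) +
          C * ((2 : ℝ≥0∞) ^ ((1 - (J : ℝ)) / 2) *
            (∑' n : ℕ, (2 : ℝ≥0∞) ^ ((4 : ℝ) * ((J + n : ℤ) : ℝ)) * blockL2 (u t) (J + n) ^ 2) ^ (1 / 2 : ℝ)) := by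
  obtain ⟨c, hc, H⟩ := supFront_clock
  obtain ⟨C, hC0, hC⟩ := exists_tsum_tail_blockSup_le_sqrt
  refine ⟨c, hc, C, hC0, fun ν T hν hT u p hmax hLH t ht J => (H ν T hν hT u p hmax hLH t ht J).trans ?_⟩
  exact add_le_add le_rfl (hC (u t) (hLH.memLp t ⟨ht.1.le, ht.2.le⟩) J)

/-! ## L53′: the dyadic-palinstrophy clock -/

/-- **L53′ — THE DYADIC-PALINSTROPHY CLOCK.** There is an absolute `κ > 0` such that for every `ν > 0`, `T > 0` and
every maximal smooth solution `(u, p)` of the unforced Navier–Stokes system on `ℝ³ × [0, T)` which is Leray–Hopf from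
`u 0`, at EVERY `t ∈ (0, T)`:
`κ · ν^{4/3} · (T − t)^{−4/3} ≤ ‖u(0)‖₂^{2/3} · ∑_{j∈ℤ} 2^{4j} ‖Δ̇_j u(t)‖₂²`
(`palinstrophy_front_clock` for every `J` and `dyadic_optimisation`). NOT sharp (printed: exponent `3/2`, no energy
factor); see the module docstring. [cite: Leray1934, §19 (3.8)–(3.9) p. 224]
[cite: BahouriCheminDanchin2011, Lemma 2.1 and Prop. 2.12] -/
theorem palinstrophy_clock :
    ∃ κ : ℝ, 0 < κ ∧ ∀ (ν T : ℝ), 0 < ν → 0 < T →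
      ∀ (u : ℝ → EuclideanSpace ℝ (Fin 3) → EuclideanSpace ℝ (Fin 3)) (p : ℝ → EuclideanSpace ℝ (Fin 3) → ℝ),
      IsMaximalSmoothSolution ν 0 u p T → IsLerayHopfOn T ν 0 (u 0) u →
      ∀ t ∈ Ioo 0 T,
        ENNReal.ofReal (κ * ν ^ (4 / 3 : ℝ) * (T - t) ^ (-(4 / 3 : ℝ))) ≤
          eLpNorm (u 0) 2 volume ^ (2 / 3 : ℝ) *
            ∑' j : ℤ, (2 : ℝ≥0∞) ^ ((4 : ℝ) * (j : ℝ)) * blockL2 (u t) j ^ 2 := by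
  obtain ⟨c, hc, C, hC0, H⟩ := palinstrophy_front_clock
  set K := lpBounds (Fin 3) with hK
  set G : ℝ≥0∞ := LPBounds.geomDim (Fin 3) with hG
  have hGtop : G ≠ ⊤ := LPBounds.geomDim_lt_top.ne
  -- real constants: head coefficient `αc` (enlarged to be positive) and tail coefficient `β`
  set αc : ℝ := max ((K.Cinf : ℝ) * G.toReal * (2 : ℝ) ^ (-(3 / 2 : ℝ))) 1 with hαc
  have hαc1 : 1 ≤ αc := le_max_right _ _
  have hαc0 : 0 < αc := lt_of_lt_of_le one_pos hαc1
  set β : ℝ := (C : ℝ) * Real.sqrt 2 with hβ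
  have hCpos : (0 : ℝ) < C := by
    have : 0 < C := pos_iff_ne_zero.2 hC0
    exact_mod_cast this
  have hβ0 : 0 < β := by positivity
  refine ⟨c ^ (8 / 3 : ℝ) / (16 * β ^ 2 * αc ^ (2 / 3 : ℝ)), by positivity,
    fun ν T hν hT u p hmax hLH t ht => ?_⟩
  have hTt : 0 < T - t := sub_pos.2 ht.2
  set E : ℝ≥0∞ := eLpNorm (u 0) 2 volume with hE
  have hEtop : E ≠ ⊤ := (hLH.memLp 0 ⟨le_rfl, hT.le⟩).eLpNorm_ne_top
  set D : ℝ≥0∞ := ∑' j : ℤ, (2 : ℝ≥0∞) ^ ((4 : ℝ) * (j : ℝ)) * blockL2 (u t) j ^ 2 with hD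
  set a : ℝ := c * Real.sqrt ν / Real.sqrt (T - t) with ha
  have ha0 : 0 < a := by positivity
  -- the front clock with the tail bounded by the whole row `D`
  have hfront : ∀ J : ℤ, ENNReal.ofReal a ≤
      (K.Cinf : ℝ≥0∞) * E * (2 : ℝ≥0∞) ^ (((J - 1 : ℤ) : ℝ) * Fintype.card (Fin 3) * 2⁻¹) * G +
        C * ((2 : ℝ≥0∞) ^ ((1 - (J : ℝ)) / 2) * D ^ (1 / 2 : ℝ)) := by
    intro J
    refine (H ν T hν hT u p hmax hLH t ht J).trans (add_le_add le_rfl (mul_le_mul' le_rfl (mul_le_mul' le_rfl ?_)))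
    refine ENNReal.rpow_le_rpow ?_ (by norm_num)
    rw [hD, CriticalLevels.tsum_int_eq_low_add_tail (fun j => (2 : ℝ≥0∞) ^ ((4 : ℝ) * (j : ℝ)) * blockL2 (u t) j ^ 2) J]
    exact le_add_self
  -- if `D = ∞` the claim is trivial unless `E = 0`, which is impossible (then `D = 0`)
  by_cases hDtop : D = ⊤
  · have hE0 : E ≠ 0 := by
      intro hE0
      -- every block of a zero field vanishes, so `D = 0`
      have hzero : ∀ j : ℤ, blockL2 (u t) j = 0 := by
        intro j
        have hut : MemLp (u t) 2 volume := hLH.memLp t ⟨ht.1.le, ht.2.le⟩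
        have h1 := K.blockL2_le hut j
        have h2 : eLpNorm (u t) 2 volume = 0 :=
          le_antisymm ((hLH.eLpNorm_le_eLpNorm_datum hν.le (hLH.memLp 0 ⟨le_rfl, hT.le⟩) ⟨ht.1.le, ht.2.le⟩).trans
            (le_of_eq hE0)) bot_le
        rw [h2, mul_zero] at h1
        exact le_antisymm h1 bot_le
      have : D = 0 := by
        rw [hD]
        simp [hzero]
      exact absurd this (by rw [hDtop]; exact ENNReal.top_ne_zero)
    rw [hDtop, ENNReal.mul_top (by simpa [ENNReal.rpow_eq_zero_iff, hEtop] using hE0)]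
    exact le_top
  -- main case: everything finite; pass to real numbers
  set d : ℝ := D.toReal with hd
  set Er : ℝ := E.toReal with hEr
  have hd0 : 0 ≤ d := ENNReal.toReal_nonneg
  have hEr0 : 0 ≤ Er := ENNReal.toReal_nonneg
  have hreal : ∀ J : ℤ, a ≤ (αc * Er) * (2 : ℝ) ^ ((3 / 2 : ℝ) * J) + β * (2 : ℝ) ^ (-(J : ℝ) / 2) * Real.sqrt d := by
    intro J
    set P : ℝ≥0∞ := (2 : ℝ≥0∞) ^ (((J - 1 : ℤ) : ℝ) * Fintype.card (Fin 3) * 2⁻¹) with hP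
    set Q : ℝ≥0∞ := (2 : ℝ≥0∞) ^ ((1 - (J : ℝ)) / 2) with hQ
    have hPtop : P ≠ ⊤ := by rw [hP]; simp [ENNReal.rpow_eq_top_iff]
    have hQtop : Q ≠ ⊤ := by rw [hQ]; simp [ENNReal.rpow_eq_top_iff]
    have hD12 : D ^ (1 / 2 : ℝ) ≠ ⊤ := ENNReal.rpow_ne_top_of_nonneg (by norm_num) hDtop
    have hXtop : (K.Cinf : ℝ≥0∞) * E * P * G + C * (Q * D ^ (1 / 2 : ℝ)) ≠ ⊤ :=
      ENNReal.add_ne_top.2 ⟨ENNReal.mul_ne_top (ENNReal.mul_ne_top (ENNReal.mul_ne_top ENNReal.coe_ne_top hEtop)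
        hPtop) hGtop, ENNReal.mul_ne_top ENNReal.coe_ne_top (ENNReal.mul_ne_top hQtop hD12)⟩
    have h1 := ENNReal.toReal_mono hXtop (hfront J)
    rw [ENNReal.toReal_ofReal ha0.le, ENNReal.toReal_add (by
        exact ENNReal.mul_ne_top (ENNReal.mul_ne_top (ENNReal.mul_ne_top ENNReal.coe_ne_top hEtop) hPtop) hGtop)
      (ENNReal.mul_ne_top ENNReal.coe_ne_top (ENNReal.mul_ne_top hQtop hD12))] at h1
    simp only [ENNReal.toReal_mul, ENNReal.coe_toReal] at h1
    have hP' : P.toReal = (2 : ℝ) ^ ((3 / 2 : ℝ) * J) * (2 : ℝ) ^ (-(3 / 2 : ℝ)) := by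
      rw [hP, ← ENNReal.toReal_rpow, ENNReal.toReal_ofNat, ← Real.rpow_add two_pos]
      congr 1
      push_cast
      simp
      ring
    have hQ' : Q.toReal = Real.sqrt 2 * (2 : ℝ) ^ (-(J : ℝ) / 2) := by
      rw [hQ, ← ENNReal.toReal_rpow, ENNReal.toReal_ofNat, Real.sqrt_eq_rpow, ← Real.rpow_add two_pos]
      congr 1
      ring
    have hD' : (D ^ (1 / 2 : ℝ)).toReal = Real.sqrt d := by
      rw [← ENNReal.toReal_rpow, Real.sqrt_eq_rpow]
    rw [hP', hQ', hD'] at h1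
    -- `K.Cinf * Er * (2^{3J/2} 2^{-3/2}) * G_r ≤ αc Er 2^{3J/2}`
    have hhead : (K.Cinf : ℝ) * Er * ((2 : ℝ) ^ ((3 / 2 : ℝ) * J) * (2 : ℝ) ^ (-(3 / 2 : ℝ))) * G.toReal ≤
        αc * Er * (2 : ℝ) ^ ((3 / 2 : ℝ) * J) := by
      have e : (K.Cinf : ℝ) * Er * ((2 : ℝ) ^ ((3 / 2 : ℝ) * J) * (2 : ℝ) ^ (-(3 / 2 : ℝ))) * G.toReal =
          ((K.Cinf : ℝ) * G.toReal * (2 : ℝ) ^ (-(3 / 2 : ℝ))) * Er * (2 : ℝ) ^ ((3 / 2 : ℝ) * J) := by ring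
      rw [e]
      refine mul_le_mul_of_nonneg_right (mul_le_mul_of_nonneg_right (le_max_left _ _) hEr0) (by positivity)
    calc a ≤ (K.Cinf : ℝ) * Er * ((2 : ℝ) ^ ((3 / 2 : ℝ) * J) * (2 : ℝ) ^ (-(3 / 2 : ℝ))) * G.toReal +
          (C : ℝ) * (Real.sqrt 2 * (2 : ℝ) ^ (-(J : ℝ) / 2) * Real.sqrt d) := h1
      _ ≤ αc * Er * (2 : ℝ) ^ ((3 / 2 : ℝ) * J) + β * (2 : ℝ) ^ (-(J : ℝ) / 2) * Real.sqrt d := by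
          rw [hβ]
          refine add_le_add hhead (le_of_eq ?_)
          ring
  have hopt := dyadic_optimisation ha0 (by positivity : 0 ≤ αc * Er) hβ0 hd0 hreal
  -- unpack: `a^{8/3} = c^{8/3} ν^{4/3} (T − t)^{−4/3}`, `(αc Er)^{2/3} = αc^{2/3} Er^{2/3}`
  have ha83 : a ^ (8 / 3 : ℝ) = c ^ (8 / 3 : ℝ) * ν ^ (4 / 3 : ℝ) * (T - t) ^ (-(4 / 3 : ℝ)) := by
    rw [ha, div_eq_mul_inv, Real.mul_rpow (by positivity) (by positivity), Real.mul_rpow hc.le (Real.sqrt_nonneg _),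
      Real.sqrt_eq_rpow, Real.sqrt_eq_rpow, ← Real.rpow_mul hν.le, Real.inv_rpow (by positivity),
      ← Real.rpow_mul hTt.le, ← Real.rpow_neg hTt.le]
    norm_num
  have hαE : (αc * Er) ^ (2 / 3 : ℝ) = αc ^ (2 / 3 : ℝ) * Er ^ (2 / 3 : ℝ) := Real.mul_rpow hαc0.le hEr0
  rw [ha83, hαE] at hopt
  -- conclude in `ℝ≥0∞`
  have hκ : c ^ (8 / 3 : ℝ) / (16 * β ^ 2 * αc ^ (2 / 3 : ℝ)) * ν ^ (4 / 3 : ℝ) * (T - t) ^ (-(4 / 3 : ℝ)) ≤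
      Er ^ (2 / 3 : ℝ) * d := by
    have hden : 0 < 16 * β ^ 2 * αc ^ (2 / 3 : ℝ) := by positivity
    rw [div_mul_eq_mul_div, div_mul_eq_mul_div, div_le_iff₀ hden]
    calc c ^ (8 / 3 : ℝ) * ν ^ (4 / 3 : ℝ) * (T - t) ^ (-(4 / 3 : ℝ))
        ≤ 16 * β ^ 2 * (αc ^ (2 / 3 : ℝ) * Er ^ (2 / 3 : ℝ)) * d := hopt
      _ = Er ^ (2 / 3 : ℝ) * d * (16 * β ^ 2 * αc ^ (2 / 3 : ℝ)) := by ring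
  have hE' : E ^ (2 / 3 : ℝ) = ENNReal.ofReal (Er ^ (2 / 3 : ℝ)) := by
    rw [hEr, ← ENNReal.ofReal_rpow_of_nonneg ENNReal.toReal_nonneg (by norm_num), ENNReal.ofReal_toReal hEtop]
  have hDd : D = ENNReal.ofReal d := (ENNReal.ofReal_toReal hDtop).symm
  rw [hE', hDd, ← ENNReal.ofReal_mul (by positivity)]
  exact ENNReal.ofReal_le_ofReal hκ

/-- **L53″ — THE `3/4`-POWER OF THE DYADIC PALINSTROPHY IS NOT INTEGRABLE AT `T`.** With the row
`X(t) = ‖u(0)‖₂^{2/3} ∑_j 2^{4j} ‖Δ̇_j u(t)‖₂²` of `palinstrophy_clock`: along every maximal smooth Leray–Hopf solution of the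
unforced system (`ν > 0`), for every `t₀ ∈ [0, T)`, `∫⁻_{(t₀,T)} X(t)^{3/4} dt = ∞` (the clock raised to the power `3/4`
is `∝ (T − t)^{−1}`; `SobolevLadderSerrin.lintegral_rpow_eq_top_of_clock`). NOT sharp: the printed Sobolev–Serrin
exponent for `Ḣ²` is `∫ P^{2/3} = ∞`. [cite: Leray1934, §19 (3.8)–(3.9) p. 224] -/
theorem palinstrophy_lintegral_eq_top {ν T : ℝ} (hν : 0 < ν) (hT : 0 < T)
    {u : ℝ → EuclideanSpace ℝ (Fin 3) → EuclideanSpace ℝ (Fin 3)} {p : ℝ → EuclideanSpace ℝ (Fin 3) → ℝ}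
    (hmax : IsMaximalSmoothSolution ν 0 u p T) (hLH : IsLerayHopfOn T ν 0 (u 0) u) {t₀ : ℝ} (ht₀ : t₀ ∈ Ico 0 T) :
    ∫⁻ τ in Ioo t₀ T, (eLpNorm (u 0) 2 volume ^ (2 / 3 : ℝ) *
        ∑' j : ℤ, (2 : ℝ≥0∞) ^ ((4 : ℝ) * (j : ℝ)) * blockL2 (u τ) j ^ 2) ^ (3 / 4 : ℝ) = ∞ := by
  obtain ⟨κ, hκ, H⟩ := palinstrophy_clock
  have h := SobolevLadderSerrin.lintegral_rpow_eq_top_of_clock (a := (4 / 3 : ℝ)) (b := (4 / 3 : ℝ)) hκ hν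
    (by norm_num) ht₀.2
    (X := fun τ => eLpNorm (u 0) 2 volume ^ (2 / 3 : ℝ) * ∑' j : ℤ, (2 : ℝ≥0∞) ^ ((4 : ℝ) * (j : ℝ)) * blockL2 (u τ) j ^ 2)
    (fun τ hτ => H ν T hν hT u p hmax hLH τ ⟨ht₀.1.trans_lt hτ.1, hτ.2⟩)
  rw [show (1 : ℝ) / (4 / 3) = 3 / 4 by norm_num] at h
  exact h

/-! ## The same clock in the toolbox's palinstrophy currency -/

/-- The `ℓ²` row of index `2` is the tree's `dyadicSqSum` with weights `2^l · 2^l`: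
`∑_j 2^{4j} a_j² = ∑_l (2^l (2^l a_l))²`. [folklore] -/
theorem tsum_four_eq_dyadicSqSum (a : ℤ → ℝ≥0∞) :
    ∑' j : ℤ, (2 : ℝ≥0∞) ^ ((4 : ℝ) * (j : ℝ)) * a j ^ 2 = dyadicSqSum (fun l => (2 : ℝ≥0∞) ^ l * a l) := by
  unfold dyadicSqSum
  refine tsum_congr fun l => ?_
  have h : (2 : ℝ≥0∞) ^ ((4 : ℝ) * (l : ℝ)) = ((2 : ℝ≥0∞) ^ l) ^ 4 := by
    rw [← ENNReal.rpow_intCast, ← ENNReal.rpow_natCast, ← ENNReal.rpow_mul]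
    congr 1
    push_cast
    ring
  rw [h]
  ring

/-- **L53′ in PALINSTROPHY currency.** With `κ` of `palinstrophy_clock`, `C_r` the reverse-Bernstein constant of the
toolbox `lpBounds (Fin 3)` and `LPBounds.hessSq v = ∑_{i,k} ‖∂_k ∂_i v‖₂²` (the squared `L²` norm of the Hessian — for a
divergence-free field the PALINSTROPHY `‖∇ω‖₂² = ‖Δv‖₂²` up to the identity `∑‖∂_i∂_k v‖² = ‖Δv‖²`): along every maximal
smooth Leray–Hopf solution of the unforced system (`ν > 0`), at EVERY `t ∈ (0, T)`:
`κ ν^{4/3} (T − t)^{−4/3} ≤ ‖u(0)‖₂^{2/3} · (72 C_r⁴ · hessSq (u(t)))` (`dyadicSqSum_four_le_dyadicD`, `dyadicD_le_hessSq`).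
NOT sharp (see the module docstring). [cite: Leray1934, §19 (3.8)–(3.9) p. 224]
[cite: BahouriCheminDanchin2011, Lemma 2.1] -/
theorem palinstrophy_clock_hessSq :
    ∃ κ : ℝ, 0 < κ ∧ ∀ (ν T : ℝ), 0 < ν → 0 < T →
      ∀ (u : ℝ → EuclideanSpace ℝ (Fin 3) → EuclideanSpace ℝ (Fin 3)) (p : ℝ → EuclideanSpace ℝ (Fin 3) → ℝ),
      IsMaximalSmoothSolution ν 0 u p T → IsLerayHopfOn T ν 0 (u 0) u →
      ∀ t ∈ Ioo 0 T,
        ENNReal.ofReal (κ * ν ^ (4 / 3 : ℝ) * (T - t) ^ (-(4 / 3 : ℝ))) ≤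
          eLpNorm (u 0) 2 volume ^ (2 / 3 : ℝ) *
            (((lpBounds (Fin 3)).Cr : ℝ≥0∞) ^ 2 *
              (8 * ((Fintype.card (Fin 3) : ℝ≥0∞) ^ 2 * (((lpBounds (Fin 3)).Cr : ℝ≥0∞) ^ 2 * LPBounds.hessSq (u t))))) := by
  obtain ⟨κ, hκ, H⟩ := palinstrophy_clock
  refine ⟨κ, hκ, fun ν T hν hT u p hmax hLH t ht => (H ν T hν hT u p hmax hLH t ht).trans ?_⟩
  set K := lpBounds (Fin 3) with hK
  have hv : IsSmoothL2Field (u t) := BlockEnergyTransport.isSmoothL2Field_slice_of_maximal hν hT hmax hLH ht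
  refine mul_le_mul' le_rfl ?_
  rw [tsum_four_eq_dyadicSqSum]
  exact (dyadicSqSum_four_le_dyadicD K hv).trans (mul_le_mul' le_rfl (K.dyadicD_le_hessSq hv))

end Summit.NavierStokesRegularity.FluidComputer.PalinstrophyClock

end
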